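import Summits.ABC.ABC.Theorems.CuspFieldPencilGoldenFromNFPencil
import Summits.ABC.ABC.Theorems.CuspFieldPencilNFPencilThreeForms
import Summits.ABC.ABC.Theorems.CuspFieldPencilNFPencilOfScoones
import HarnessLib

/-!
# Sketch (stub-ideation k=1): helper-lemma statements for `stub_conjugateCuspTriple`
(crux stmt-ABC-26026 `GoldenCuspShadow`, route CuspFieldPencil). Statements only; `sorry` bodies.
-/

set_option linter.dupNamespace false

namespace Summit.ABC.ABC.Theorems

open NumberField UniqueFactorizationMonoid QuadraticAlgebra

namespace ConjugateCuspTriple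

/-- The registered stub signature, verbatim (`Sig.stub_conjugateCuspTriple` of the birth skeleton). -/
def Sig : Prop :=
  ∀ ε : ℝ, 0 < ε → ∃ κ : ℝ, ∀ u w : ℤ, IsCoprime u w → u * w * (u ^ 2 - 11 * u * w - w ^ 2) ≠ 0 → Real.log (max (|(u : ℝ)|) (|(w : ℝ)|)) ≤ κ * (((UniqueFactorizationMonoid.radical (u * w * (u ^ 2 - 11 * u * w - w ^ 2))).natAbs : ℕ) : ℝ) ^ (ε : ℝ) * ((((UniqueFactorizationMonoid.radical (u ^ 2 - 11 * u * w - w ^ 2)).natAbs : ℕ) : ℝ) ^ (2 / 3 : ℝ) * (min (((UniqueFactorizationMonoid.radical u).natAbs : ℕ) : ℝ) (((UniqueFactorizationMonoid.radical w).natAbs : ℕ) : ℝ)) ^ (2 / 3 : ℝ))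

/-- H0. The three-forms number-field pencil bound (exponent `1/3 + ε`) over class-number-one fields:
verbatim the hypothesis of `nfPencilBound_of_threeForms` = the conclusion of `threeForms_of_scoones2021`. -/
def ThreeFormsNF : Prop :=
  ∀ (K : Type) [Field K] [NumberField K], IsPrincipalIdealRing (𝓞 K) →
    ∀ (α β : Fin 3 → 𝓞 K), (∀ i j, i ≠ j → α i * β j ≠ α j * β i) → ∀ ε : ℝ, 0 < ε →
      ∃ C : ℝ, ∀ u w : ℤ, IsCoprime u w →
        (∏ i, (α i * (u : 𝓞 K) + β i * (w : 𝓞 K))) ≠ 0 →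
          Real.log ((max |u| |w| : ℤ) : ℝ) ≤ C *
            ((∏ i, Ideal.absNorm (Ideal.span {α i * (u : 𝓞 K) + β i * (w : 𝓞 K)}).radical : ℕ) : ℝ) ^
              (1 / (3 : ℝ) + ε)

/-- H0a: from the Scoones named fact (landed three-forms theorem, by name). -/
theorem threeFormsNF_of_scoones2021
    (hS : Literature.NumberTheory.DiophantineGeometry.scoones2021_abcNumberField_classNumberOne) :
    ThreeFormsNF :=
  NFPencilThreeForms.threeForms_of_scoones2021 hS

/-- H0b: from the sibling crux `NFPencilBound` at `k = 3`. -/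
theorem threeFormsNF_of_nfPencilBound
    (h : Summit.ABC.ABC.Theses.CuspFieldPencil.NFPencilBound) : ThreeFormsNF := by
  intro K _ _ hPID α β hprop ε hε
  obtain ⟨C, hC⟩ := h K hPID 3 α β le_rfl hprop ε hε
  refine ⟨C, fun u w hcop hne => ?_⟩
  have h1 := hC u w hcop hne
  have h3 : (1 / ((3 : ℕ) : ℝ) + ε) = (1 / (3 : ℝ) + ε) := by norm_num
  rw [h3] at h1
  exact h1

/-- H1 (conjugate pair bookkeeping): in a quadratic field containing `θ` with `θ² = θ + 1`,
for coprime `u, w` with `Q = u² − 11uw − w² ≠ 0`: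
`N(rad(u + β₂w)) · N(rad(u + β₃w)) ≤ N((5(2θ−1))) · rad(Q)²`. -/
theorem conjPair_absNorm_radical_le (K : Type*) [Field K] [NumberField K]
    (hdeg : Module.finrank ℚ K = 2) (θ β₂ β₃ : 𝓞 K) (hθ : θ * θ = θ + 1)
    (h₂ : β₂ = -3 - 5 * θ) (h₃ : β₃ = -8 + 5 * θ) {u w : ℤ} (hcop : IsCoprime u w)
    (hQ : u ^ 2 - 11 * u * w - w ^ 2 ≠ 0) :
    Ideal.absNorm (Ideal.span {(u : 𝓞 K) + β₂ * w}).radical *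
        Ideal.absNorm (Ideal.span {(u : 𝓞 K) + β₃ * w}).radical ≤
      Ideal.absNorm (Ideal.span {(5 * (2 * θ - 1) : 𝓞 K)}) *
        (radical (u ^ 2 - 11 * u * w - w ^ 2)).natAbs ^ 2 := by
  sorry

/-- H2 (real step, exponent 1/3): `L ≤ C·P^{1/3+ε/2}`, `P ≤ C₀·X²` ⟹ `L ≤ (max C 0 · C₀^{1/3+ε/2}) · X^{2/3+ε}`. -/
theorem real_step_third {L C ε : ℝ} {P C₀ X : ℕ} (hε : 0 < ε)
    (hL : L ≤ C * (P : ℝ) ^ (1 / (3 : ℝ) + ε / 2)) (hP : P ≤ C₀ * X ^ 2) :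
    L ≤ (max C 0 * (C₀ : ℝ) ^ (1 / (3 : ℝ) + ε / 2)) * (X : ℝ) ^ (2 / 3 + ε : ℝ) := by
  set e : ℝ := 1 / (3 : ℝ) + ε / 2 with he
  have he0 : 0 ≤ e := by rw [he]; positivity
  have hPR : (P : ℝ) ≤ (C₀ : ℝ) * (X : ℝ) ^ 2 := by exact_mod_cast hP
  have hPe : (P : ℝ) ^ e ≤ ((C₀ : ℝ) * (X : ℝ) ^ 2) ^ e :=
    Real.rpow_le_rpow (Nat.cast_nonneg _) hPR he0
  have hsplit : ((C₀ : ℝ) * (X : ℝ) ^ 2) ^ e = (C₀ : ℝ) ^ e * (X : ℝ) ^ (2 / 3 + ε : ℝ) := by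
    rw [Real.mul_rpow (Nat.cast_nonneg _) (pow_nonneg (Nat.cast_nonneg _) 2)]
    congr 1
    rw [show ((X : ℝ) ^ 2) = (X : ℝ) ^ (2 : ℝ) by norm_cast, ← Real.rpow_mul (Nat.cast_nonneg _)]
    congr 1
    rw [he]; ring
  have hPe0 : 0 ≤ (P : ℝ) ^ e := Real.rpow_nonneg (Nat.cast_nonneg _) e
  calc L ≤ C * (P : ℝ) ^ e := hL
    _ ≤ max C 0 * (P : ℝ) ^ e := mul_le_mul_of_nonneg_right (le_max_left _ _) hPe0
    _ ≤ max C 0 * (((C₀ : ℝ) * (X : ℝ) ^ 2) ^ e) :=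
        mul_le_mul_of_nonneg_left hPe (le_max_right _ _)
    _ = (max C 0 * (C₀ : ℝ) ^ e) * (X : ℝ) ^ (2 / 3 + ε : ℝ) := by rw [hsplit, mul_assoc]

/-- H3w (one-sided bound, third form `w`): Scoones/three-forms on `(x₊, x₋, w)`:
`log max(|u|,|w|) ≤ C · (rad Q · rad w)^{2/3+ε}`. -/
theorem side_w (h3 : ThreeFormsNF) :
    ∀ ε : ℝ, 0 < ε → ∃ C : ℝ, ∀ u w : ℤ, IsCoprime u w →
      u * w * (u ^ 2 - 11 * u * w - w ^ 2) ≠ 0 →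
        Real.log (max (|(u : ℝ)|) (|(w : ℝ)|)) ≤ C *
          (((radical (u ^ 2 - 11 * u * w - w ^ 2)).natAbs * (radical w).natAbs : ℕ) : ℝ) ^
            (2 / 3 + ε : ℝ) := by
  sorry

/-- H3u (one-sided bound, third form `u`): Scoones/three-forms on `(x₊, x₋, u)`. -/
theorem side_u (h3 : ThreeFormsNF) :
    ∀ ε : ℝ, 0 < ε → ∃ C : ℝ, ∀ u w : ℤ, IsCoprime u w →
      u * w * (u ^ 2 - 11 * u * w - w ^ 2) ≠ 0 →
        Real.log (max (|(u : ℝ)|) (|(w : ℝ)|)) ≤ C *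
          (((radical (u ^ 2 - 11 * u * w - w ^ 2)).natAbs * (radical u).natAbs : ℕ) : ℝ) ^
            (2 / 3 + ε : ℝ) := by
  sorry

/-- H4 (real min-assembly): two one-sided bounds ⟹ the `min` form with the `R^ε` slack
(`R = a·b·q ≥ q·a, q·b`; `min(a,b)^{2/3} = min(a^{2/3}, b^{2/3})`); the conclusion is associated
exactly as the registered signature: `κ * R^ε * (q^{2/3} * min^{2/3})`. -/
theorem real_min_assembly {L K ε : ℝ} {a b q : ℕ} (hK : 0 ≤ K) (hε : 0 ≤ ε)
    (ha : 1 ≤ a) (hb : 1 ≤ b) (hq : 1 ≤ q)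
    (h1 : L ≤ K * ((q * a : ℕ) : ℝ) ^ (2 / 3 + ε : ℝ))
    (h2 : L ≤ K * ((q * b : ℕ) : ℝ) ^ (2 / 3 + ε : ℝ)) :
    L ≤ K * ((a * b * q : ℕ) : ℝ) ^ (ε : ℝ) * ((q : ℝ) ^ (2 / 3 : ℝ) *
      (min (a : ℝ) (b : ℝ)) ^ (2 / 3 : ℝ)) := by
  -- generic one-sided step: from `L ≤ K (q c)^{2/3+ε}` with `q c ≤ a b q` to `K R^ε q^{2/3} c^{2/3}`
  have key : ∀ c : ℕ, 1 ≤ c → q * c ≤ a * b * q →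
      L ≤ K * ((q * c : ℕ) : ℝ) ^ (2 / 3 + ε : ℝ) →
      L ≤ K * ((a * b * q : ℕ) : ℝ) ^ (ε : ℝ) * ((q : ℝ) ^ (2 / 3 : ℝ) * (c : ℝ) ^ (2 / 3 : ℝ)) := by
    intro c hc hle h
    have hqc0 : (0 : ℝ) ≤ ((q * c : ℕ) : ℝ) := Nat.cast_nonneg _
    have hsplit : ((q * c : ℕ) : ℝ) ^ (2 / 3 + ε : ℝ) =
        (q : ℝ) ^ (2 / 3 : ℝ) * (c : ℝ) ^ (2 / 3 : ℝ) * ((q * c : ℕ) : ℝ) ^ (ε : ℝ) := by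
      rw [Real.rpow_add' hqc0 (by positivity), Nat.cast_mul,
        Real.mul_rpow (Nat.cast_nonneg _) (Nat.cast_nonneg _)]
    have hRle : ((q * c : ℕ) : ℝ) ^ (ε : ℝ) ≤ ((a * b * q : ℕ) : ℝ) ^ (ε : ℝ) :=
      Real.rpow_le_rpow hqc0 (by exact_mod_cast hle) hε
    have hq0 : (0 : ℝ) ≤ (q : ℝ) ^ (2 / 3 : ℝ) := Real.rpow_nonneg (Nat.cast_nonneg _) _
    have hc0 : (0 : ℝ) ≤ (c : ℝ) ^ (2 / 3 : ℝ) := Real.rpow_nonneg (Nat.cast_nonneg _) _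
    calc L ≤ K * ((q * c : ℕ) : ℝ) ^ (2 / 3 + ε : ℝ) := h
      _ = K * ((q : ℝ) ^ (2 / 3 : ℝ) * (c : ℝ) ^ (2 / 3 : ℝ) * ((q * c : ℕ) : ℝ) ^ (ε : ℝ)) := by
          rw [hsplit]
      _ ≤ K * ((q : ℝ) ^ (2 / 3 : ℝ) * (c : ℝ) ^ (2 / 3 : ℝ) * ((a * b * q : ℕ) : ℝ) ^ (ε : ℝ)) := by
          gcongr
      _ = K * ((a * b * q : ℕ) : ℝ) ^ (ε : ℝ) * ((q : ℝ) ^ (2 / 3 : ℝ) * (c : ℝ) ^ (2 / 3 : ℝ)) := by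
          ring
  rcases le_total a b with hab | hab
  · have hmin : min (a : ℝ) (b : ℝ) = (a : ℝ) := min_eq_left (by exact_mod_cast hab)
    rw [hmin]
    exact key a ha (calc q * a = q * a * 1 := (mul_one _).symm
      _ ≤ q * a * b := Nat.mul_le_mul_left _ hb
      _ = a * b * q := by ring) h1
  · have hmin : min (a : ℝ) (b : ℝ) = (b : ℝ) := min_eq_right (by exact_mod_cast hab)
    rw [hmin]
    exact key b hb (calc q * b = q * b * 1 := (mul_one _).symm
      _ ≤ q * b * a := Nat.mul_le_mul_left _ ha
      _ = a * b * q := by ring) h2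

/-- H5 (assembly): the stub signature from the three-forms bound. -/
theorem sig_of_threeFormsNF (h3 : ThreeFormsNF) : Sig := by
  intro ε hε
  obtain ⟨Cw, hCw⟩ := side_w h3 ε hε
  obtain ⟨Cu, hCu⟩ := side_u h3 ε hε
  refine ⟨max (max Cw Cu) 0, fun u w hcop hne => ?_⟩
  rw [GoldenFromNFPencil.natAbs_radical_prod hcop]
  have ha : 1 ≤ (radical u).natAbs := Int.natAbs_pos.mpr radical_ne_zero
  have hb : 1 ≤ (radical w).natAbs := Int.natAbs_pos.mpr radical_ne_zero
  have hq : 1 ≤ (radical (u ^ 2 - 11 * u * w - w ^ 2)).natAbs := Int.natAbs_pos.mpr radical_ne_zero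
  have hK : 0 ≤ max (max Cw Cu) 0 := le_max_right _ _
  have h1 := hCu u w hcop hne
  have h2 := hCw u w hcop hne
  have h1' : Real.log (max (|(u : ℝ)|) (|(w : ℝ)|)) ≤ max (max Cw Cu) 0 *
      (((radical (u ^ 2 - 11 * u * w - w ^ 2)).natAbs * (radical u).natAbs : ℕ) : ℝ) ^
        (2 / 3 + ε : ℝ) :=
    h1.trans (mul_le_mul_of_nonneg_right ((le_max_right _ _).trans (le_max_left _ _))
      (Real.rpow_nonneg (Nat.cast_nonneg _) _))
  have h2' : Real.log (max (|(u : ℝ)|) (|(w : ℝ)|)) ≤ max (max Cw Cu) 0 *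
      (((radical (u ^ 2 - 11 * u * w - w ^ 2)).natAbs * (radical w).natAbs : ℕ) : ℝ) ^
        (2 / 3 + ε : ℝ) :=
    h2.trans (mul_le_mul_of_nonneg_right ((le_max_left _ _).trans (le_max_left _ _))
      (Real.rpow_nonneg (Nat.cast_nonneg _) _))
  exact real_min_assembly hK hε.le ha hb hq h1' h2'

/-- Unconditional implication from the sibling crux. -/
theorem sig_of_nfPencilBound (h : Summit.ABC.ABC.Theses.CuspFieldPencil.NFPencilBound) : Sig :=
  sig_of_threeFormsNF (threeFormsNF_of_nfPencilBound h)

/-- PROVED-MOD-FACT form (Scoones 2023 Thm 3, cite-only fact, by name). -/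
theorem sig_of_scoones2021
    (hS : Literature.NumberTheory.DiophantineGeometry.scoones2021_abcNumberField_classNumberOne) : Sig :=
  sig_of_threeFormsNF (threeFormsNF_of_scoones2021 hS)

end ConjugateCuspTriple

end Summit.ABC.ABC.Theorems
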